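import Summits.BirchSwinnertonDyer.BirchSwinnertonDyer.Theorems.Rank2ObservatoryRank3PSatCert
import HarnessLib

/-!
# BirchSwinnertonDyer — rank ≥ 2 observatory: rank-3 `p`-saturation certificates, normalised classes

HONEST FRAMING: per-curve certified theorems and census instruments; no claim on BSD in rank ≥ 2.

A DENSITY REFINEMENT of the row certificate `Rank2ObservatoryRank3PSatCert.rank3PSatCheck`: the
coset `p•E(ℚ) + E(ℚ)[p^u]` is a subgroup on which multiples prime to `p` are invertible
(`mem_pCoset_of_isCoprime_zsmul_mem`), so a witness is needed only for the `p² + p + 1` NORMALISED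
residue triples `(1, b, c)`, `(0, 1, c)`, `(0, 0, 1)` (points of `ℙ²(𝔽_p)`) instead of all
`p³ − 1` triples `≠ 0`: `residues_of_normalised` derives the full hypothesis `hw` of
`listedSpan_saturated_of_not_mem_pCoset` from the normalised one (scale a class by the inverse of
its leading residue, `mem_pCoset_normalise`). The row Boolean `rank3PSatCheckN` is `rank3PSatCheck`
with `normTriples p` in place of `triples p` (same datum `Rank3PSatCert`, `13` witnesses per row
for `p = 3` instead of `26`, `31` instead of `124` for `p = 5`); soundness
`Rank3Row.pSaturated_of_pSatCheckN[All]` with the same conclusion (the listed span is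
`p`-saturated in `E(ℚ)`). Sorry-free; no `decide` executed in this file.

References: S. Siksek, Rocky Mountain J. Math. 25 (1995) §3; J. E. Cremona, *Algorithms for
Modular Elliptic Curves* (1997) §3.5.
-/

-- single-conjunct summit: `Summit.BirchSwinnertonDyer.BirchSwinnertonDyer.…` repeats the name
set_option linter.dupNamespace false

namespace Summit.BirchSwinnertonDyer.BirchSwinnertonDyer.Rank2Observatory

open WeierstrassCurve

/-! ### Normalised residue triples suffice -/

section Normalised

variable {A : Type*} [AddCommGroup A] {P₁ P₂ P₃ : A}

/-- A residue in `[0, p)` divisible by `p` is `0`. [folklore] -/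
private theorem eq_zero_of_dvd_of_lt {p : ℕ} {a : ℤ} (ha : 0 ≤ a) (ha' : a < p)
    (h : (p : ℤ) ∣ a) : a = 0 := by
  obtain ⟨n, rfl⟩ := Int.eq_ofNat_of_zero_le ha
  have hn : n < p := by exact_mod_cast ha'
  have h0 : n = 0 := Nat.eq_zero_of_dvd_of_lt (Int.natCast_dvd_natCast.mp h) hn
  simp [h0]

/-- **Normalisation**: if `λ a + μ p = 1` and `aP₁ + bP₂ + cP₃ ∈ p•A + A[p^u]` then
`P₁ + (λb mod p)P₂ + (λc mod p)P₃ ∈ p•A + A[p^u]` (multiply by `λ`, absorb the multiples of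
`p`). [folklore] -/
theorem mem_pCoset_normalise {p u : ℕ} {a b c l m : ℤ} (hl : l * a + m * p = 1)
    (h : a • P₁ + b • P₂ + c • P₃ ∈ pCoset A p u) :
    P₁ + (l * b % p) • P₂ + (l * c % p) • P₃ ∈ pCoset A p u := by
  have h2 := AddSubgroup.zsmul_mem _ h l
  have eb := Int.emod_add_ediv_mul (l * b) (p : ℤ)
  have ec := Int.emod_add_ediv_mul (l * c) (p : ℤ)
  have e : P₁ + (l * b % p) • P₂ + (l * c % p) • P₃ =
      l • (a • P₁ + b • P₂ + c • P₃) +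
        (p : ℤ) • (m • P₁ + (-(l * b / p)) • P₂ + (-(l * c / p)) • P₃) := by
    have e₁ : (1 : ℤ) = l * a + (p : ℤ) * m := by linear_combination -hl
    have e₂ : l * b % p = l * b + (p : ℤ) * (-(l * b / p)) := by linear_combination eb
    have e₃ : l * c % p = l * c + (p : ℤ) * (-(l * c / p)) := by linear_combination ec
    calc P₁ + (l * b % p) • P₂ + (l * c % p) • P₃
        = (1 : ℤ) • P₁ + (l * b % p) • P₂ + (l * c % p) • P₃ := by rw [one_smul]
      _ = (l * a + (p : ℤ) * m) • P₁ + (l * b + (p : ℤ) * (-(l * b / p))) • P₂ +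
            (l * c + (p : ℤ) * (-(l * c / p))) • P₃ := by rw [← e₁, ← e₂, ← e₃]
      _ = l • (a • P₁ + b • P₂ + c • P₃) +
            (p : ℤ) • (m • P₁ + (-(l * b / p)) • P₂ + (-(l * c / p)) • P₃) := by module
  rw [e]
  exact AddSubgroup.add_mem _ h2 (natCast_zsmul_mem_pCoset p u _)

/-- **Normalised classes suffice.** Witnesses for the `p² + p + 1` triples `(1, b, c)`, `(0, 1, c)`,
`(0, 0, 1)` give the witness hypothesis for every residue triple `≠ 0`
(`listedSpan_saturated_of_not_mem_pCoset`'s `hw`). [folklore] -/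
theorem residues_of_normalised {p u : ℕ} (hp : p.Prime)
    (h₁ : ∀ b c : ℤ, 0 ≤ b → b < p → 0 ≤ c → c < p → P₁ + b • P₂ + c • P₃ ∉ pCoset A p u)
    (h₂ : ∀ c : ℤ, 0 ≤ c → c < p → P₂ + c • P₃ ∉ pCoset A p u) (h₃ : P₃ ∉ pCoset A p u) :
    ∀ a b c : ℤ, 0 ≤ a → a < p → 0 ≤ b → b < p → 0 ≤ c → c < p →
      ¬ (a = 0 ∧ b = 0 ∧ c = 0) → a • P₁ + b • P₂ + c • P₃ ∉ pCoset A p u := by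
  intro a b c ha ha' hb hb' hc hc' hne hmem
  have hp0 : (0 : ℤ) < p := by exact_mod_cast hp.pos
  by_cases hpa : (p : ℤ) ∣ a
  · obtain rfl := eq_zero_of_dvd_of_lt ha ha' hpa
    by_cases hpb : (p : ℤ) ∣ b
    · obtain rfl := eq_zero_of_dvd_of_lt hb hb' hpb
      by_cases hpc : (p : ℤ) ∣ c
      · exact hne ⟨rfl, rfl, eq_zero_of_dvd_of_lt hc hc' hpc⟩
      · simp only [zero_smul, zero_add] at hmem
        exact h₃ (mem_pCoset_of_isCoprime_zsmul_mem (isCoprime_of_prime_of_not_dvd hp hpc) hmem)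
    · obtain ⟨l, m, hl⟩ := isCoprime_of_prime_of_not_dvd hp hpb
      have h' : b • P₂ + c • P₃ + (0 : ℤ) • P₃ ∈ pCoset A p u := by
        simpa only [zero_smul, zero_add, add_zero] using hmem
      have h'' := mem_pCoset_normalise hl h'
      simp only [mul_zero, Int.zero_emod, zero_smul, add_zero] at h''
      exact h₂ _ (Int.emod_nonneg _ hp0.ne') (Int.emod_lt_of_pos _ hp0) h''
  · obtain ⟨l, m, hl⟩ := isCoprime_of_prime_of_not_dvd hp hpa
    exact h₁ _ _ (Int.emod_nonneg _ hp0.ne') (Int.emod_lt_of_pos _ hp0)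
      (Int.emod_nonneg _ hp0.ne') (Int.emod_lt_of_pos _ hp0) (mem_pCoset_normalise hl hmem)

end Normalised

/-! ### The normalised triples as a list -/

/-- The `p² + p + 1` normalised residue triples `(1, b, c)`, `(0, 1, c)`, `(0, 0, 1)`. [folklore] -/
def normTriples (p : ℕ) : List (ℤ × ℤ × ℤ) :=
  ((List.range p).flatMap fun b : ℕ =>
      (List.range p).map fun c : ℕ => ((1 : ℤ), ((b : ℕ) : ℤ), ((c : ℕ) : ℤ))) ++
    ((List.range p).map fun c : ℕ => ((0 : ℤ), (1 : ℤ), ((c : ℕ) : ℤ))) ++ [((0 : ℤ), 0, 1)]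

/-- `(1, b, c)` is listed. [folklore] -/
theorem mem_normTriples₁ {p : ℕ} {b c : ℤ} (hb : 0 ≤ b) (hb' : b < p) (hc : 0 ≤ c)
    (hc' : c < p) : (1, b, c) ∈ normTriples p := by
  obtain ⟨b, rfl⟩ := Int.eq_ofNat_of_zero_le hb
  obtain ⟨c, rfl⟩ := Int.eq_ofNat_of_zero_le hc
  have hb₁ : b < p := by exact_mod_cast hb'
  have hc₁ : c < p := by exact_mod_cast hc'
  refine List.mem_append_left _ (List.mem_append_left _ (List.mem_flatMap.mpr
    ⟨b, List.mem_range.mpr hb₁, List.mem_map.mpr ⟨c, List.mem_range.mpr hc₁, rfl⟩⟩))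

/-- `(0, 1, c)` is listed. [folklore] -/
theorem mem_normTriples₂ {p : ℕ} {c : ℤ} (hc : 0 ≤ c) (hc' : c < p) :
    (0, 1, c) ∈ normTriples p := by
  obtain ⟨c, rfl⟩ := Int.eq_ofNat_of_zero_le hc
  have hc₁ : c < p := by exact_mod_cast hc'
  exact List.mem_append_left _ (List.mem_append_right _
    (List.mem_map.mpr ⟨c, List.mem_range.mpr hc₁, rfl⟩))

/-- `(0, 0, 1)` is listed. [folklore] -/
theorem mem_normTriples₃ (p : ℕ) : ((0 : ℤ), (0 : ℤ), (1 : ℤ)) ∈ normTriples p :=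
  List.mem_append_right _ (List.mem_singleton.mpr rfl)

/-! ### The certificate on the scaled model, normalised classes -/

/-- Extraction of the witness of a listed class. [folklore] -/
private theorem witness_of_all {l : List (ℤ × ℤ × ℤ)} {ws : List PWitness} {P : PWitness → Bool}
    (hall : l.all (fun abc => ws.any fun w => decide ((w.a, w.b, w.c) = abc) && P w) = true)
    {abc : ℤ × ℤ × ℤ} (h : abc ∈ l) : ∃ w ∈ ws, (w.a, w.b, w.c) = abc ∧ P w = true := by
  have h1 := List.all_eq_true.mp hall _ h
  simp only [List.any_eq_true, Bool.and_eq_true, decide_eq_true_eq] at h1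
  obtain ⟨w, hw, hwabc, hP⟩ := h1
  exact ⟨w, hw, hwabc, hP⟩

open scoped Classical in
/-- **`p`-saturation on the integral model from NORMALISED witnesses** (as `pSaturated_of_certP`,
with `residues_of_normalised`). [cite: CremonaAlgorithms1997, §3.5] -/
theorem pSaturated_of_certPN (V : WeierstrassCurve ℤ) (hΔ : V.Δ ≠ 0) {X₁ Y₁ X₂ Y₂ X₃ Y₃ : ℤ}
    (e₁ : Y₁ ^ 2 + V.a₁ * X₁ * Y₁ + V.a₃ * Y₁ = X₁ ^ 3 + V.a₂ * X₁ ^ 2 + V.a₄ * X₁ + V.a₆)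
    (e₂ : Y₂ ^ 2 + V.a₁ * X₂ * Y₂ + V.a₃ * Y₂ = X₂ ^ 3 + V.a₂ * X₂ ^ 2 + V.a₄ * X₂ + V.a₆)
    (e₃ : Y₃ ^ 2 + V.a₁ * X₃ * Y₃ + V.a₃ * Y₃ = X₃ ^ 3 + V.a₂ * X₃ ^ 2 + V.a₄ * X₃ + V.a₆)
    {p : ℕ} (hp : p.Prime) {S : List (ℕ × ℕ)} {t : ℕ}
    (hS : ∀ ℓN ∈ S, ℓN.1.Prime ∧
      ∀ (x : (V.map (Int.castRingHom ℚ)).toAffine.Point) (n : ℕ), ¬ ℓN.1 ∣ n → n • x = 0 →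
        ℓN.2 • x = 0)
    (ht : annihilatorCheck S t = true) (hpt : ¬ (p : ℤ) ∣ (t : ℤ)) {Q : List (ℕ × ℕ)}
    (hQ : Q.all (killerB V) = true) {ws : List PWitness}
    (hall : (normTriples p).all (fun abc =>
      ws.any fun w => decide ((w.a, w.b, w.c) = abc) && pWitnessB V p Q X₁ Y₁ X₂ Y₂ X₃ Y₃ w)
      = true) :
    ∀ x : (V.map (Int.castRingHom ℚ)).toAffine.Point,
      p • x ∈ AddSubgroup.closure
          {Affine.Point.some (X₁ : ℚ) (Y₁ : ℚ) (nonsingular_rat_of_eq V hΔ e₁),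
            Affine.Point.some (X₂ : ℚ) (Y₂ : ℚ) (nonsingular_rat_of_eq V hΔ e₂),
            Affine.Point.some (X₃ : ℚ) (Y₃ : ℚ) (nonsingular_rat_of_eq V hΔ e₃)} ⊔
          AddCommGroup.torsion _ →
      x ∈ AddSubgroup.closure
          {Affine.Point.some (X₁ : ℚ) (Y₁ : ℚ) (nonsingular_rat_of_eq V hΔ e₁),
            Affine.Point.some (X₂ : ℚ) (Y₂ : ℚ) (nonsingular_rat_of_eq V hΔ e₂),
            Affine.Point.some (X₃ : ℚ) (Y₃ : ℚ) (nonsingular_rat_of_eq V hΔ e₃)} ⊔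
          AddCommGroup.torsion _ := by
  refine listedSpan_saturated_of_not_mem_pCoset hp (u := 0) (m := (t : ℤ))
    (isCoprime_of_prime_of_not_dvd hp hpt) ?_ (residues_of_normalised hp ?_ ?_ ?_)
  · intro x hx
    rw [pow_zero, one_mul, natCast_zsmul]
    exact nsmul_eq_zero_of_annihilatorCheck hS ht hx
  · intro b c hb hb' hc hc'
    obtain ⟨w, -, hwabc, hwB⟩ := witness_of_all hall (mem_normTriples₁ hb hb' hc hc')
    simp only [Prod.mk.injEq] at hwabc
    obtain ⟨hwa, rfl, rfl⟩ := hwabc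
    have key := not_mem_pCoset_of_pWitnessB V hΔ hQ e₁ e₂ e₃ hwB
    rw [hwa] at key
    simpa only [one_smul, one_zsmul] using key
  · intro c hc hc'
    obtain ⟨w, -, hwabc, hwB⟩ := witness_of_all hall (mem_normTriples₂ hc hc')
    simp only [Prod.mk.injEq] at hwabc
    obtain ⟨hwa, hwb, rfl⟩ := hwabc
    have key := not_mem_pCoset_of_pWitnessB V hΔ hQ e₁ e₂ e₃ hwB
    rw [hwa, hwb] at key
    simpa only [zero_smul, zero_zsmul, zero_add, one_smul, one_zsmul] using key
  · obtain ⟨w, -, hwabc, hwB⟩ := witness_of_all hall (mem_normTriples₃ p)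
    simp only [Prod.mk.injEq] at hwabc
    obtain ⟨hwa, hwb, hwc⟩ := hwabc
    have key := not_mem_pCoset_of_pWitnessB V hΔ hQ e₁ e₂ e₃ hwB
    rw [hwa, hwb, hwc] at key
    simpa only [zero_smul, zero_zsmul, zero_add, one_smul, one_zsmul] using key

/-! ### The row certificate, normalised classes -/

/-- **The row Boolean, normalised classes** (kernel `decide`): `rank3PSatCheck` with
`normTriples p` in place of `triples p`. [cite: CremonaAlgorithms1997, §3.5] -/
def rank3PSatCheckN (r : Rank3Row) (p : ℕ) (c : Rank3PSatCert) : Bool :=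
  let V := scaleModel r.intModel c.d
  decide (c.d ≠ 0 ∧ V.Δ ≠ 0 ∧ p.Prime ∧ ¬ (p : ℤ) ∣ (c.t : ℤ) ∧
      c.X₁ * r.P₁.2.2 = c.d ^ 2 * r.P₁.1 ∧ c.Y₁ * r.P₁.2.2 = c.d ^ 3 * r.P₁.2.1 ∧
      c.X₂ * r.P₂.2.2 = c.d ^ 2 * r.P₂.1 ∧ c.Y₂ * r.P₂.2.2 = c.d ^ 3 * r.P₂.2.1 ∧
      c.X₃ * r.P₃.2.2 = c.d ^ 2 * r.P₃.1 ∧ c.Y₃ * r.P₃.2.2 = c.d ^ 3 * r.P₃.2.1 ∧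
      c.Y₁ ^ 2 + V.a₁ * c.X₁ * c.Y₁ + V.a₃ * c.Y₁ =
        c.X₁ ^ 3 + V.a₂ * c.X₁ ^ 2 + V.a₄ * c.X₁ + V.a₆ ∧
      c.Y₂ ^ 2 + V.a₁ * c.X₂ * c.Y₂ + V.a₃ * c.Y₂ =
        c.X₂ ^ 3 + V.a₂ * c.X₂ ^ 2 + V.a₄ * c.X₂ + V.a₆ ∧
      c.Y₃ ^ 2 + V.a₁ * c.X₃ * c.Y₃ + V.a₃ * c.Y₃ =
        c.X₃ ^ 3 + V.a₂ * c.X₃ ^ 2 + V.a₄ * c.X₃ + V.a₆) &&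
  annihilatorCheck c.S c.t && c.S.all (killerB V) && c.Q.all (killerB V) &&
  (normTriples p).all fun abc =>
    c.ws.any fun w => decide ((w.a, w.b, w.c) = abc) &&
      pWitnessB V p c.Q c.X₁ c.Y₁ c.X₂ c.Y₂ c.X₃ c.Y₃ w

/-- **SOUNDNESS of the row certificate, normalised classes**: the listed span
`ℤP₁ + ℤP₂ + ℤP₃ + E(ℚ)_tors` is `p`-SATURATED in `E(ℚ) = r.curve⟮ℚ⟯`.
[cite: CremonaAlgorithms1997, §3.5] [cite: SilvermanAEC2009, III.3.1(b)] -/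
theorem Rank3Row.pSaturated_of_pSatCheckN (r : Rank3Row) (h : r.check = true) (p : ℕ)
    (c : Rank3PSatCert) (hc : rank3PSatCheckN r p c = true) :
    ∀ a : r.curve.toAffine.Point,
      p • a ∈ AddSubgroup.closure {r.gen₁ h, r.gen₂ h, r.gen₃ h} ⊔ AddCommGroup.torsion _ →
        a ∈ AddSubgroup.closure {r.gen₁ h, r.gen₂ h, r.gen₃ h} ⊔ AddCommGroup.torsion _ := by
  simp only [rank3PSatCheckN, Bool.and_eq_true, decide_eq_true_eq] at hc
  obtain ⟨⟨⟨⟨⟨hd, hΔ, hp, hpt, hX₁, hY₁, hX₂, hY₂, hX₃, hY₃, e₁, e₂, e₃⟩, hann⟩, hS⟩, hQ⟩,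
    hall⟩ := hc
  exact r.pSaturated_of_scaled h hd hX₁ hY₁ hX₂ hY₂ hX₃ hY₃ hΔ e₁ e₂ e₃ p
    (pSaturated_of_certPN _ hΔ e₁ e₂ e₃ hp (killers_of_all_killerB _ hS) hann hpt hQ hall)

/-- The normalised Boolean over a list of rows and certificates (same order). [folklore] -/
def rank3PSatCheckNAll (p : ℕ) : List Rank3Row → List Rank3PSatCert → Bool
  | [], _ => true
  | _ :: _, [] => false
  | r :: rs, c :: cs => rank3PSatCheckN r p c && rank3PSatCheckNAll p rs cs

/-- **Soundness of the list form, normalised classes.** [cite: CremonaAlgorithms1997, §3.5] -/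
theorem Rank3Row.pSaturated_of_pSatCheckNAll (p : ℕ) :
    ∀ {rows : List Rank3Row} {cs : List Rank3PSatCert}, rank3PSatCheckNAll p rows cs = true →
      ∀ r ∈ rows, ∀ h : r.check = true, ∀ a : r.curve.toAffine.Point,
        p • a ∈ AddSubgroup.closure {r.gen₁ h, r.gen₂ h, r.gen₃ h} ⊔ AddCommGroup.torsion _ →
          a ∈ AddSubgroup.closure {r.gen₁ h, r.gen₂ h, r.gen₃ h} ⊔ AddCommGroup.torsion _
  | [], _, _ => by simp
  | _ :: _, [], hc => by simp [rank3PSatCheckNAll] at hc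
  | r :: rs, c :: cs, hc => by
    rw [rank3PSatCheckNAll, Bool.and_eq_true] at hc
    intro r' hr'
    rcases List.mem_cons.mp hr' with rfl | hmem
    · exact fun h => r'.pSaturated_of_pSatCheckN h p c hc.1
    · exact Rank3Row.pSaturated_of_pSatCheckNAll p hc.2 r' hmem

end Summit.BirchSwinnertonDyer.BirchSwinnertonDyer.Rank2Observatory
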